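import Summits.ResolutionOfSingularities.ResolutionOfSingularities.Theorems.UniversalCellsPrimeFieldToPerfectStubTower
import Summits.ResolutionOfSingularities.ResolutionOfSingularities.Theorems.UniversalCellsPrimeFieldToPerfectStubSeparableDescent
import Mathlib.RingTheory.AlgebraicIndependent.TranscendenceBasis
import Mathlib.RingTheory.AlgebraicIndependent.Basic
import Mathlib.FieldTheory.IntermediateField.Adjoin.Algebra
import Mathlib.FieldTheory.IntermediateField.Adjoin.Basic
import Mathlib.FieldTheory.PurelyInseparable.PerfectClosure
import Mathlib.RingTheory.MvPolynomial.Basic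
import Mathlib.RingTheory.Localization.FractionRing
import Mathlib.Algebra.CharP.Algebra
import HarnessLib

/-!
# [OURS · L1 W8.2] DOOR 1 IS PINNED TO THE RATIONAL TOWER: resolution over the perfect closures of the purely
# transcendental fields `𝔽_p(t₁,…,t_d)` gives resolution over every perfect field of characteristic `p`

Cell `res-hironaka` (run/shared/lean/pub/res-hironaka/), LADDER-RESOLUTION rung L (RESCUE), slot W8.2; host route
`UniversalCells`, host item `PrimeFieldToPerfect` (stmt-ResolutionOfSingularities-15233), door 1. Proofs file
(Theses-free), written by res-L1-s82-pv-1 (gen 4).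

THE CELL. The crux `PrimeFieldToPerfect` (`Res(𝔽_p) ⇒ Res(k)` for every perfect `k` of characteristic `p`) is
reduced in the tree to resolution over the perfect closures `K^{perf}` of ALL finitely generated fields `K`
(`Theorems.PrimeFieldToPerfect.stub_separableDescent`, p149298). THIS FILE pins it further, to the COUNTABLY MANY
COUNTABLE fields `(𝔽_p(t_i : i ∈ ι))^{perf}`, `ι` finite — stated intrinsically as «`M` perfect and purely
inseparable over `FractionRing (MvPolynomial ι (ZMod p))`»:

* `integralRes_perfectClosure_fg_of_rationalTower` — if every such `M` (every finite `ι`, INCLUDING `ι = ∅`,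
  where `M ≅ 𝔽_p`) carries resolution of all integral separated schemes of finite type, then so does every perfect
  `L` purely inseparable over a finitely generated field `K`. PROOF (finite push-forward, no base change): choose a
  transcendence basis `t ⊆ K` of `K/𝔽_p` inside a finite generating set (Mathlib
  `exists_isTranscendenceBasis_subset`); inside `L` let `F₁` be the `p`-radical closure of `𝔽_p(t)` (the tree's
  `tower_exists_forall_mem_iff`; perfect by `tower_perfectField_of_forall_mem_iff`); `F₁` is purely inseparable
  over `Frac 𝔽_p[t] ≅ 𝔽_p(t)`, so `Res(F₁)` holds by hypothesis; `L` is ALGEBRAIC over `F₁` (over `𝔽_p[t]` through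
  `K`) and generated over `F₁` by the finitely many images of the generators of `K` up to `p`-power roots, which
  the perfect field `F₁(generators)` already contains — so `L` is FINITE over `F₁`, `Spec L ⟶ Spec F₁` is of finite
  type, and an integral separated `L`-scheme of finite type is an integral separated `F₁`-scheme of finite type;
* `rationalTower_of_isEmpty_of_primeField` — the `ι = ∅` instance follows from `Res(𝔽_p)` (such an `M` is `𝔽_p` up to
  a bijective algebra map, again a finite push-forward);
* **`perfectRes_of_primeField_of_rationalTower`** — `Res(𝔽_p)` and the tower hypothesis for NON-EMPTY finite `ι`
  give resolution over EVERY perfect field of characteristic `p` (by `stub_separableDescent`); with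
  `…PerfectionDescentLinks.integralRes_tower_mono` (the tower is monotone) any cofinal set of levels suffices.

HONEST FRAMING. OURS theorems about OURS statements (role replaced: §17 ¶2 p.89 l.59–62 of [Hironaka2017], typed AS
PRINTED as `S17Methodology.U89_3`); NOT statements of the manuscript; nothing attributed to its author; no typed
candidate used. Nothing here touches the open residual (`PerfectionStepAt M n`, `n ≥ 4`); this is bookkeeping of
WHICH constant fields the residual must be proved at. AI work, weaker than expert review; no claim beyond the
kernel.
-/

noncomputable section

set_option linter.dupNamespace false -- mandated namespace of this single-conjunct summit

open CategoryTheory CategoryTheory.Limits AlgebraicGeometry TopologicalSpace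
open Literature.AlgebraicGeometry.Resolution
open Summit.ResolutionOfSingularities.ResolutionOfSingularities.Theorems.PrimeFieldToPerfect

namespace Summit.ResolutionOfSingularities.ResolutionOfSingularities.Theorems.CampaignW82

/-- A field generated (as a field) by a set `s` is algebraic over the subalgebra generated by `s`: every element
is a quotient `y / z` of elements of the subring generated by `s`. [folklore] -/
theorem isAlgebraic_adjoin_of_closure_eq_top {F K : Type} [Field F] [Field K] [Algebra F K] (s : Set K)
    (hs : Subfield.closure s = ⊤) : Algebra.IsAlgebraic (Algebra.adjoin F s) K := by
  refine ⟨fun x => ?_⟩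
  have hx : x ∈ Subfield.closure s := hs ▸ Subfield.mem_top x
  obtain ⟨y, hy, z, hz, rfl⟩ := (Subfield.mem_closure_iff).mp hx
  have hsub : Subring.closure s ≤ (Algebra.adjoin F s).toSubring :=
    Subring.closure_le.mpr Algebra.subset_adjoin
  have hy' : y ∈ Algebra.adjoin F s := hsub hy
  have hz' : z ∈ Algebra.adjoin F s := hsub hz
  by_cases hz0 : z = 0
  · rw [hz0, div_zero]; exact isAlgebraic_zero
  refine ⟨Polynomial.C ⟨z, hz'⟩ * Polynomial.X - Polynomial.C ⟨y, hy'⟩, ?_, ?_⟩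
  · intro h
    have h1 := congrArg (fun P : Polynomial (Algebra.adjoin F s) => P.coeff 1) h
    simp only [Polynomial.coeff_sub, Polynomial.coeff_C_mul, Polynomial.coeff_X_one, mul_one,
      Polynomial.coeff_C_succ, sub_zero, Polynomial.coeff_zero] at h1
    exact hz0 (congrArg Subtype.val h1)
  · simp only [map_sub, map_mul, Polynomial.aeval_C, Polynomial.aeval_X, Subalgebra.algebraMap_def,
      Algebra.algebraMap_self, RingHom.id_apply]
    rw [mul_div_cancel₀ _ hz0, sub_self]

/-- **From the rational tower to all finitely generated fields (finite push-forward).** See the module docstring.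
[folklore] -/
theorem integralRes_perfectClosure_fg_of_rationalTower (p : ℕ) (hp : p.Prime)
    (htower : ∀ (ι : Type) [Finite ι] (M : Type) [Field M] [PerfectField M]
      [Algebra (FractionRing (MvPolynomial ι (ZMod p))) M]
      [IsPurelyInseparable (FractionRing (MvPolynomial ι (ZMod p))) M],
      ∀ (X : Scheme.{0}) (f : X ⟶ Spec (.of M)), IsSeparated f → LocallyOfFiniteType f →
        QuasiCompact f → IsIntegral X → Scheme.HasResolution X)
    (K : Type) [Field K] [CharP K p] (hK : ∃ s : Finset K, Subfield.closure (s : Set K) = ⊤)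
    (L : Type) [Field L] [PerfectField L] [Algebra K L] [IsPurelyInseparable K L]
    (X : Scheme.{0}) (f : X ⟶ Spec (.of L)) (hs : IsSeparated f) (hl : LocallyOfFiniteType f)
    (hq : QuasiCompact f) (hX : IsIntegral X) : Scheme.HasResolution X := by
  classical
  haveI : Fact p.Prime := ⟨hp⟩
  haveI : CharP L p := charP_of_injective_algebraMap (algebraMap K L).injective p
  haveI : ExpChar K p := ExpChar.prime hp
  haveI : ExpChar L p := ExpChar.prime hp
  letI : Algebra (ZMod p) K := ZMod.algebra K p
  letI : Algebra (ZMod p) L := ZMod.algebra L p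
  haveI : IsScalarTower (ZMod p) K L :=
    IsScalarTower.of_algebraMap_eq' (Subsingleton.elim _ _)
  haveI : FaithfulSMul (ZMod p) K := (faithfulSMul_iff_algebraMap_injective _ _).mpr (algebraMap (ZMod p) K).injective
  let φKL : K →ₐ[ZMod p] L := IsScalarTower.toAlgHom (ZMod p) K L
  have hφKL : Function.Injective φKL := (algebraMap K L).injective
  obtain ⟨s, hsK⟩ := hK
  -- ### a finite transcendence basis `t ⊆ s` of `K / 𝔽_p`
  haveI := isAlgebraic_adjoin_of_closure_eq_top (F := ZMod p) (↑s : Set K) hsK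
  obtain ⟨t, hts, ht⟩ := exists_isTranscendenceBasis_subset (R := ZMod p) (A := K) (↑s : Set K)
  haveI : Finite t := (s.finite_toSet.subset hts).to_subtype
  let A₀ : Subalgebra (ZMod p) K := Algebra.adjoin (ZMod p) (Set.range (Subtype.val : t → K))
  haveI : Algebra.IsAlgebraic A₀ K := ht.isAlgebraic
  -- ### `F₁ ⊆ L`: the `p`-radical closure of `𝔽_p(t)` inside `L`; perfect
  let S' : Set L := φKL '' Set.range (Subtype.val : t → K)
  obtain ⟨F₁, hF₁⟩ := tower_exists_forall_mem_iff p (IntermediateField.adjoin (ZMod p) S')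
  haveI : PerfectField F₁ := tower_perfectField_of_forall_mem_iff p hF₁
  have hmemF₁ : ∀ y : L, y ∈ IntermediateField.adjoin (ZMod p) S' → y ∈ F₁ := fun y hy =>
    (hF₁ y).2 ⟨0, by rwa [pow_zero, pow_one]⟩
  have hA₀F₁ : ∀ a : A₀, φKL a ∈ F₁ := fun a => hmemF₁ _ (by
    have h1 : φKL a ∈ Algebra.adjoin (ZMod p) S' := by
      rw [← AlgHom.map_adjoin]; exact ⟨a, a.2, rfl⟩
    exact IntermediateField.algebra_adjoin_le_adjoin (ZMod p) S' h1)
  -- ### `L` is algebraic over `F₁` (through `A₀ = 𝔽_p[t] ⊆ K`)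
  let θ : A₀ →+* F₁ := (φKL.toRingHom.comp A₀.val.toRingHom).codRestrict F₁ hA₀F₁
  letI : Algebra A₀ F₁ := θ.toAlgebra
  haveI : IsScalarTower A₀ F₁ L := IsScalarTower.of_algebraMap_eq fun _ => rfl
  haveI : Algebra.IsAlgebraic K L := inferInstance
  haveI : Algebra.IsAlgebraic A₀ L := Algebra.IsAlgebraic.trans (R := A₀) (S := K) (A := L)
  have hθ : Function.Injective (algebraMap A₀ F₁) := fun a b h =>
    Subtype.ext (hφKL (congrArg Subtype.val h :))
  haveI : Algebra.IsAlgebraic F₁ L := Algebra.IsAlgebraic.extendScalars (R := A₀) (S := F₁) (A := L) hθ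
  -- ### `L = F₁(s)` is finite over `F₁`
  let s'' : Set L := φKL '' (↑s : Set K)
  haveI : Finite s'' := (s.finite_toSet.image _).to_subtype
  let E : IntermediateField F₁ L := IntermediateField.adjoin F₁ s''
  haveI : FiniteDimensional F₁ E :=
    IntermediateField.finiteDimensional_adjoin fun y _ => (Algebra.IsAlgebraic.isAlgebraic (R := F₁) y).isIntegral
  have hE : E = ⊤ := by
    haveI : PerfectField E := Algebra.IsAlgebraic.perfectField F₁
    haveI : CharP E p := ((algebraMap E L).charP_iff_charP p).mpr inferInstance
    haveI : ExpChar E p := ExpChar.prime hp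
    rw [eq_top_iff]
    intro x _
    obtain ⟨n, k, hk⟩ := IsPurelyInseparable.pow_mem K p x
    -- `algebraMap K L k ∈ E`
    have hsE : Subfield.closure (↑s : Set K) ≤ E.toSubfield.comap (algebraMap K L) :=
      Subfield.closure_le.mpr fun y hy => IntermediateField.subset_adjoin F₁ s'' ⟨y, hy, rfl⟩
    have hkE : algebraMap K L k ∈ E := hsE (hsK ▸ Subfield.mem_top k)
    -- `x ^ p ^ n ∈ E`, `E` perfect ⇒ `x ∈ E`
    have hxn : x ^ p ^ n ∈ E := hk ▸ hkE
    obtain ⟨y, hy⟩ := (bijective_iterateFrobenius E p n).2 ⟨x ^ p ^ n, hxn⟩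
    have hy' : (y : L) ^ p ^ n = x ^ p ^ n := by
      have := congrArg Subtype.val hy
      simpa [iterateFrobenius_def] using this
    have hyx : (y : L) = x := iterateFrobenius_inj L p n (by rwa [iterateFrobenius_def, iterateFrobenius_def])
    exact hyx ▸ y.2
  haveI : FiniteDimensional F₁ L := by
    have e : E ≃ₗ[F₁] L := (IntermediateField.equivOfEq hE).toLinearEquiv.trans IntermediateField.topEquiv.toLinearEquiv
    exact Module.Finite.equiv e
  haveI : Algebra.FiniteType F₁ L := inferInstance
  -- ### `F₁` is purely inseparable over `Frac 𝔽_p[t]`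
  let t' : t → F₁ := fun i => ⟨φKL i.1, hmemF₁ _ (IntermediateField.subset_adjoin _ _ ⟨i.1, ⟨i, rfl⟩, rfl⟩)⟩
  have ht' : AlgebraicIndependent (ZMod p) t' := by
    refine AlgebraicIndependent.of_comp F₁.val ?_
    exact ht.1.map' (f := φKL) hφKL
  let Rp := MvPolynomial t (ZMod p)
  let F := FractionRing Rp
  have hae : Function.Injective (MvPolynomial.aeval t' : Rp →ₐ[ZMod p] F₁) :=
    algebraicIndependent_iff_injective_aeval.mp ht'
  let ψ : F →+* F₁ := IsFractionRing.lift (g := (MvPolynomial.aeval t' : Rp →ₐ[ZMod p] F₁).toRingHom) hae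
  letI : Algebra F F₁ := ψ.toAlgebra
  haveI : CharP Rp p := inferInstance
  haveI : CharP F p := charP_of_injective_algebraMap (IsFractionRing.injective Rp F) p
  haveI : ExpChar F p := ExpChar.prime hp
  haveI : IsPurelyInseparable F F₁ := by
    refine (isPurelyInseparable_iff_pow_mem F p).2 fun x => ?_
    obtain ⟨n, hn⟩ := (hF₁ x.1).1 x.2
    refine ⟨n, ?_⟩
    -- the range of `ψ` is an intermediate field containing the `t' i`
    have hψc : ∀ c : ZMod p, ψ (algebraMap (ZMod p) F c) = algebraMap (ZMod p) F₁ c := fun c =>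
      congrFun (congrArg DFunLike.coe (Subsingleton.elim (ψ.comp (algebraMap (ZMod p) F))
        (algebraMap (ZMod p) F₁))) c
    let Sψ : IntermediateField (ZMod p) F₁ :=
      { ψ.fieldRange with algebraMap_mem' := fun c => ⟨algebraMap (ZMod p) F c, hψc c⟩ }
    have hle : IntermediateField.adjoin (ZMod p) (Set.range t') ≤ Sψ := by
      refine IntermediateField.adjoin_le_iff.mpr ?_
      rintro _ ⟨i, rfl⟩
      refine ⟨algebraMap Rp F (MvPolynomial.X i), ?_⟩
      change ψ _ = _
      rw [IsFractionRing.lift_algebraMap]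
      change MvPolynomial.aeval t' (MvPolynomial.X i) = t' i
      exact MvPolynomial.aeval_X t' i
    -- transport `hn` from `L` to `F₁`
    have hmap : (IntermediateField.adjoin (ZMod p) (Set.range t')).map F₁.val =
        IntermediateField.adjoin (ZMod p) S' := by
      rw [IntermediateField.adjoin_map]
      congr 1
      ext y
      constructor
      · rintro ⟨_, ⟨i, rfl⟩, rfl⟩; exact ⟨i.1, ⟨i, rfl⟩, rfl⟩
      · rintro ⟨_, ⟨i, rfl⟩, rfl⟩; exact ⟨t' i, ⟨i, rfl⟩, rfl⟩
    have hx : x ^ p ^ n ∈ IntermediateField.adjoin (ZMod p) (Set.range t') := by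
      have h1 : (x : L) ^ p ^ n ∈ (IntermediateField.adjoin (ZMod p) (Set.range t')).map F₁.val := hmap ▸ hn
      rw [← SetLike.mem_coe, IntermediateField.coe_map] at h1
      obtain ⟨z, hz, hzx⟩ := h1
      have : z = x ^ p ^ n := Subtype.ext (by simpa using hzx)
      exact this ▸ hz
    exact hle hx
  -- ### `Res(F₁)` by the tower hypothesis, pushed forward along the finite-type `Spec L ⟶ Spec F₁`
  have hres := htower t F₁
  let g : Spec (.of L) ⟶ Spec (.of (F₁ : Type)) := Spec.map (CommRingCat.ofHom (algebraMap F₁ L))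
  haveI : LocallyOfFiniteType g :=
    (HasRingHomProperty.Spec_iff (P := @LocallyOfFiniteType)).mpr
      (RingHom.finiteType_algebraMap.mpr inferInstance)
  haveI := hs; haveI := hl; haveI := hq; haveI := hX
  exact hres X (f ≫ g) inferInstance inferInstance inferInstance hX


/-- **The empty level of the tower is `𝔽_p`**: for `ι` empty, a perfect field `M` purely inseparable over
`Frac 𝔽_p[∅] = 𝔽_p` receives a SURJECTIVE ring map from `ZMod p` (every step `ZMod p → 𝔽_p[∅] → Frac → M` is
surjective: the last because `M` is separable — `Frac 𝔽_p[∅]` is finite, hence perfect — and purely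
inseparable over it), so `Spec M ⟶ Spec (ZMod p)` is of finite type and resolution over `ZMod p` pushes
forward. [folklore] -/
theorem rationalTower_of_isEmpty_of_primeField (p : ℕ) (hp : p.Prime)
    (h₀ : ∀ (X : Scheme.{0}) (f : X ⟶ Spec (.of (ZMod p))), IsSeparated f → LocallyOfFiniteType f →
      QuasiCompact f → IsIntegral X → Scheme.HasResolution X)
    (ι : Type) [IsEmpty ι] (M : Type) [Field M] [PerfectField M]
    [Algebra (FractionRing (MvPolynomial ι (ZMod p))) M]
    [IsPurelyInseparable (FractionRing (MvPolynomial ι (ZMod p))) M]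
    (X : Scheme.{0}) (f : X ⟶ Spec (.of M)) (hs : IsSeparated f) (hl : LocallyOfFiniteType f)
    (hq : QuasiCompact f) (hX : IsIntegral X) : Scheme.HasResolution X := by
  classical
  haveI : Fact p.Prime := ⟨hp⟩
  let Rp := MvPolynomial ι (ZMod p)
  let F := FractionRing Rp
  have h1 : Function.Surjective (algebraMap (ZMod p) Rp) := MvPolynomial.C_surjective ι
  have h2 : Function.Surjective (algebraMap Rp F) := by
    intro z
    obtain ⟨⟨a, b⟩, hz⟩ := IsLocalization.surj (nonZeroDivisors Rp) z
    obtain ⟨c, hc⟩ := h1 b.1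
    have hc0 : c ≠ 0 := fun h => nonZeroDivisors.ne_zero b.2 (by rw [← hc, h, map_zero])
    have hu : IsUnit (b.1 : Rp) := hc ▸ (IsUnit.mk0 c hc0).map _
    obtain ⟨u, hu'⟩ := hu
    refine ⟨a * ↑u⁻¹, ?_⟩
    have hne : algebraMap Rp F ↑u ≠ 0 := ((Units.isUnit u).map (algebraMap Rp F)).ne_zero
    rw [map_mul, map_units_inv]
    symm
    rw [eq_mul_inv_iff_mul_eq₀ hne, hu']
    simpa using hz
  haveI : Finite F := Finite.of_surjective _ (h2.comp h1)
  haveI : PerfectField F := PerfectField.ofFinite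
  haveI : Algebra.IsSeparable F M := Algebra.IsAlgebraic.isSeparable_of_perfectField
  have h3 : Function.Surjective (algebraMap F M) := IsPurelyInseparable.surjective_algebraMap_of_isSeparable F M
  let φ : ZMod p →+* M := (algebraMap F M).comp ((algebraMap Rp F).comp (algebraMap (ZMod p) Rp))
  have hφ : Function.Surjective φ := h3.comp (h2.comp h1)
  have hft : φ.FiniteType := RingHom.FiniteType.of_surjective φ hφ
  let g : Spec (.of M) ⟶ Spec (.of (ZMod p)) := Spec.map (CommRingCat.ofHom φ)
  haveI : LocallyOfFiniteType g := (HasRingHomProperty.Spec_iff (P := @LocallyOfFiniteType)).mpr hft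
  haveI := hs; haveI := hl; haveI := hq
  exact h₀ X (f ≫ g) inferInstance inferInstance inferInstance hX

/-- **DOOR 1 PINNED TO THE RATIONAL TOWER (integral schemes).** Let `p` be prime. Assume resolution of all
integral separated schemes of finite type over `ZMod p` (the crux's hypothesis), and over every perfect field
purely inseparable over `Frac 𝔽_p[t_i : i ∈ ι]` for every NON-EMPTY finite `ι` (the rational tower
`(𝔽_p(t₁,…,t_d))^{perf}`, `d ≥ 1`). Then every integral separated scheme of finite type over every perfect field
of characteristic `p` has a resolution (`integralRes_perfectClosure_fg_of_rationalTower` +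
`rationalTower_of_isEmpty_of_primeField` + `PrimeFieldToPerfect.stub_separableDescent`). [folklore] -/
theorem perfectRes_of_primeField_of_rationalTower (p : ℕ) (hp : p.Prime)
    (h₀ : ∀ (X : Scheme.{0}) (f : X ⟶ Spec (.of (ZMod p))), IsSeparated f → LocallyOfFiniteType f →
      QuasiCompact f → IsIntegral X → Scheme.HasResolution X)
    (htower : ∀ (ι : Type) [Finite ι] [Nonempty ι] (M : Type) [Field M] [PerfectField M]
      [Algebra (FractionRing (MvPolynomial ι (ZMod p))) M]
      [IsPurelyInseparable (FractionRing (MvPolynomial ι (ZMod p))) M],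
      ∀ (X : Scheme.{0}) (f : X ⟶ Spec (.of M)), IsSeparated f → LocallyOfFiniteType f →
        QuasiCompact f → IsIntegral X → Scheme.HasResolution X)
    (k : Type) [Field k] [CharP k p] [PerfectField k] (X : Scheme.{0}) (f : X ⟶ Spec (.of k))
    (hs : IsSeparated f) (hl : LocallyOfFiniteType f) (hq : QuasiCompact f) (hX : IsIntegral X) :
    Scheme.HasResolution X :=
  stub_separableDescent p hp
    (fun K _ _ hK L _ _ _ _ Y g hs' hl' hq' hY =>
      integralRes_perfectClosure_fg_of_rationalTower p hp
        (fun ι _ M _ _ _ _ Z h hsZ hlZ hqZ hZ => by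
          cases isEmpty_or_nonempty ι with
          | inl hι => exact rationalTower_of_isEmpty_of_primeField p hp h₀ ι M Z h hsZ hlZ hqZ hZ
          | inr hι => exact htower ι M Z h hsZ hlZ hqZ hZ)
        K hK L Y g hs' hl' hq' hY)
    k X f hs hl hq hX

/-- **The same for REDUCED schemes** (the conclusion shape of the crux `PrimeFieldToPerfect` at `p`): by the
tree's componentwise reduction `Theorems.descentReducedToIntegral_proof` (stmt-0551). [folklore] -/
theorem reducedRes_of_primeField_of_rationalTower (p : ℕ) (hp : p.Prime)
    (h₀ : ∀ (X : Scheme.{0}) (f : X ⟶ Spec (.of (ZMod p))), IsSeparated f → LocallyOfFiniteType f →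
      QuasiCompact f → IsIntegral X → Scheme.HasResolution X)
    (htower : ∀ (ι : Type) [Finite ι] [Nonempty ι] (M : Type) [Field M] [PerfectField M]
      [Algebra (FractionRing (MvPolynomial ι (ZMod p))) M]
      [IsPurelyInseparable (FractionRing (MvPolynomial ι (ZMod p))) M],
      ∀ (X : Scheme.{0}) (f : X ⟶ Spec (.of M)), IsSeparated f → LocallyOfFiniteType f →
        QuasiCompact f → IsIntegral X → Scheme.HasResolution X)
    (k : Type) [Field k] [CharP k p] [PerfectField k] (X : Scheme.{0}) (f : X ⟶ Spec (.of k))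
    (hs : IsSeparated f) (hl : LocallyOfFiniteType f) (hq : QuasiCompact f) (hX : IsReduced X) :
    Scheme.HasResolution X :=
  Summit.ResolutionOfSingularities.ResolutionOfSingularities.Theorems.descentReducedToIntegral_proof k
    (fun Y g hs' hl' hq' hY => perfectRes_of_primeField_of_rationalTower p hp h₀ htower k Y g hs' hl' hq' hY)
    X f hs hl hq hX

end Summit.ResolutionOfSingularities.ResolutionOfSingularities.Theorems.CampaignW82

end
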